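import Literature.MathematicalPhysics.QuantumFieldTheory.YangMillsOS
import Literature.MathematicalPhysics.QuantumFieldTheory.SpeciesTimeReflection
import HarnessLib

/-!
# `MoebiusRow` — DEBT CERTIFICATE: `CompositeAFDebts → MoebiusRow`, PROVED (typing: ideator ym-idea-3 g26, HOME `g26/moebius-row-debts.lean`
# a7b9b290bb3d399e; proofs + landing: free-hands seat ym-line-frs-p2 g20 on director-ym «GO (b)» 2026-08-30T01:52:57Z;
# `--supports stmt-QuantumFields-23763 --as helper`)

THIS FILE PROVES ONLY THE REDUCTION `moebiusRow_of_debts : CompositeAFDebts → MoebiusRow` (and its real-analysis core `moebius_step`).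
`CompositeAFDebts` = U0 ∧ ∃(u → 0⁺) 𝒢 η₁, U1 ∧ U2 below are OPEN DEBTS — U0 is S–M lattice bookkeeping, U1 (lattice → finite-volume continuum
dictionary, Bałaban UV-stability class with a composite insertion) and U2 (one asymptotic-freedom block step of the continuum profile) are XL and
NOT proved anywhere; `MoebiusRow` (the registered stub `stub_moebiusRow` of `Cruxes/SubCurvatureClause/Lines/rp_moebius_ladder.lean`) stays OPEN —
its content is now BY NAME `CompositeAFDebts`.  Every letter below is byte-identical to g26's typing file (critic idea-crit-4 typing-grade stamp
2026-08-30T01:48:39Z, remark R2: U2 alone is junk-inhabited by constant profiles, the package is not).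


`MoebiusRow` (the shared XL asymptotic-freedom stub of ⟨stmt-QuantumFields-23763⟩'s registered line `rp-moebius-ladder` and of the
⟨stmt-QuantumFields-24275⟩ export line) is INTRINSIC: no unit, no continuum object.  frs-p2's honest split is `U1 ∧ U2` — a
lattice→continuum DICTIONARY in an intrinsic unit `u(β) → 0` and continuum composite ASYMPTOTIC FREEDOM of the profile — plus the
lattice-artefact floor.  This file TYPES the three debts so that `MoebiusRow ⇐ U0 ∧ (∃ u 𝒢 η₁, U1 ∧ U2)` is a kernel-checkable piece of real
analysis, and records the paper proof (kernel-checked in §3; every letter is vendored byte-identically from the registered Lines file).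

* `LatticeUVFloor r` (U0, S–M): at FIXED lattice distances `t ≤ T` the symmetrised axis coupling tends to `0` as `β → ∞`, uniformly in the
  torus (`|lcc| ≤ ‖Q‖∞·⟨Q⟩_β` and the plaquette expectation `→ 0`).
* `ContinuumDictionary r u 𝒢 η₁` (U1, XL — Bałaban UV-stability class, composite insertion): inside the INTRINSIC weak-coupling window
  (`Gs ≤ η₁` at all scales `≤ t`), for `t ≥ T(ν)` and `β ≥ β₁(ν)`, the lattice coupling equals the FINITE-VOLUME continuum profile
  `𝒢(ℓ, x)` at torus size `ℓ = (2L+1)·u(β)` and separation `x = 2t·u(β)` up to relative error `ν`, uniformly in `L ≥ 4t+8`.  The profile is a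
  two-variable real function (torus size, separation): finite-size effects live INSIDE `𝒢`, so no fixed relative finite-size error competes
  with the one-loop gain (the reason a one-variable dictionary would be FALSE as a supplier of the row for small floors `δ`).
* `ProfileAFRow 𝒢` (U2, XL — RG-improved perturbation theory for the `tr F²` pair as a THEOREM about continuum finite-volume Yang–Mills):
  on every mesh `h ≤ h₀`, if `𝒢(ℓ, 2sh) ≤ η₂` at the grid scales `t ≤ s ≤ Λt` (window typed ON THE LATTICE GRID, as frs-p2 required — a
  continuum-interval window cannot be fed from the stub's discrete hypothesis), then `1/√𝒢(ℓ,2th) ≥ 1/√𝒢(ℓ,2Λth) + b` and `𝒢(ℓ,2Λth) > 0`.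

PAPER PROOF of `moebiusRow_of_debts` (kernel-checked in §3).  Fix `G, r`; take `Λ, b, η₂, h₀` from U2, `η₁` from U1;
the row's constants are `Λ`, `b/2`, `η := min η₁ (η₂/2)`.  Given `δ > 0` put `ν := min (1/4) (b·√δ/8)`, get `T, β₁'` from U1 at `ν`, `β₀`
from U0 at `(δ, T)`, `βᵤ` with `u β ≤ h₀` for `β ≥ βᵤ`; `β₁ := max`.  Let `β ≥ β₁`, `1 ≤ t`, `4Λt+8 ≤ L`, window `Gs(s) ≤ η ∀ s ∈ [1, Λt]`.
CASE `t < T`: U0 gives `Gs(t) ≤ δ`.  CASE `T ≤ t`: with `h := u β`, `ℓ := (2L+1)h`, U1 applies at every `s ∈ [t, Λt]` (window up to `s`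
holds at level `η ≤ η₁`, `T ≤ s`, `4s+8 ≤ L`): `|Gs(s) − 𝒢(ℓ,2sh)| ≤ ν·𝒢(ℓ,2sh)`, whence `𝒢(ℓ,2sh) ≤ Gs(s)/(1−ν) ≤ 2η ≤ η₂` — the U2
grid window; U2 gives `A := 1/√𝒢_Λ`, `𝒢_Λ := 𝒢(ℓ,2Λth) > 0`, `1/√𝒢_t ≥ A + b` (so `𝒢_t > 0`, `𝒢_t < 𝒢_Λ`).  Sub-case `𝒢_Λ < (4ν/b)²`:
`Gs(t) ≤ (1+ν)𝒢_t ≤ (5/4)(4ν/b)² ≤ (5/4)·δ/4 ≤ δ`.  Sub-case `𝒢_Λ ≥ (4ν/b)²`, i.e. `A ≤ b/(4ν)`: `1/√Gs(t) ≥ (1+ν)^{-1/2}(A + b) ≥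
(1 − ν/2)(A + b)` and `1/√Gs(Λt) ≤ (1−ν)^{-1/2}·A ≤ (1+ν)·A` (`ν ≤ 1/4`); then `(1 − ν/2)(A+b) − (1+ν)A − b/2 = b/2 − νb/2 − (3/2)νA ≥
3b/8 − (3/2)ν·b/(4ν) = 0`, so `1/√Gs(t) ≥ 1/√Gs(Λt) + b/2`, equivalently `Gs(t) ≤ moebius (b/2) (Gs(Λt))` (`1/√(moebius c u) = 1/√u + c`
for `u > 0`; here `Gs(Λt) ≥ (1−ν)𝒢_Λ > 0` and `Gs(t) ≥ (1−ν)𝒢_t > 0`).  ∎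

HONEST LABEL: TYPING ONLY.  U0 is S–M; U1 and U2 are OPEN and XL (the asymptotic-freedom half of the problem for one composite
correlator); `MoebiusRow`, `CrossoverDecay`, ⟨23763⟩, ⟨24275⟩ and the Yang–Mills mass gap are NOT proved; no summit is proved by a line.
-/

set_option autoImplicit false

noncomputable section

open MeasureTheory Filter Topology
open Literature.MathematicalPhysics.QuantumFieldTheory Literature.MathematicalPhysics.QuantumLattice

namespace Summit.QuantumFields.YangMills.Cruxes.SubCurvatureClause.MoebiusRowDebts

/-! ## §1 Letters (vendored byte-identically from `Lines/rp_moebius_ladder.lean` 995e59ee23adafad :60–:107) -/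

section Objects

variable {G : Type} [Group G] [TopologicalSpace G] [IsTopologicalGroup G] [CompactSpace G]
  [MeasurableSpace G] [BorelSpace G]

/-- **The on-axis dimensionless curvature coupling** `G(β, L, t) := (2t)⁸ · lCC_{β,2L+1}(Q^θ, Q, 2t)`: the connected time-correlation
(tree `latticeConnectedCorr`) of Wilson's corner action density `Q = r.curvature.F` against its site-time-reflected variant
`Q^θ = r.curvature.timeReflect.F` at EVEN time separation `2t` on the odd torus `2L+1`, times `(2t)⁸`.  No unit map, no scheme, no
renormalisation constant. -/
def axisG (r : LatticeRep G) (β : ℝ) (L t : ℕ) : ℝ :=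
  ((2 * t : ℕ) : ℝ) ^ 8 *
    latticeConnectedCorr r.ρ β (2 * L + 1) r.curvature.timeReflect.F r.curvature.F (2 * t)

/-- The MIRROR ORDER of the reflected pair, `G'(β, L, t) := (2t)⁸ · lCC_{β,2L+1}(Q, Q^θ, 2t)` — also a reflection-positive square
(`⟨Q_{−t} · Θ₀(Q_{−t})⟩`), NOT equal to `axisG` on the lattice (`Q^θ` is not a translate of `Q`: tree `torusDensity_timeReflect`,
`reflDensity_sub_torusDensity` — the two orders differ by one backward time-difference of the electric part). -/
def axisG' (r : LatticeRep G) (β : ℝ) (L t : ℕ) : ℝ :=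
  ((2 * t : ℕ) : ℝ) ^ 8 *
    latticeConnectedCorr r.ρ β (2 * L + 1) r.curvature.F r.curvature.timeReflect.F (2 * t)

/-- **The SYMMETRISED on-axis coupling** `Gs := max G G'` over the two orders of the reflected pair (stub letters rev 3, g25: forced by the
agreed two-sided letter of `LatticeToAxis` — lattice axis domination `CurvatureKernel.AxisDominationOfForm` consumes BOTH orders). -/
def axisGs (r : LatticeRep G) (β : ℝ) (L t : ℕ) : ℝ :=
  max (axisG r β L t) (axisG' r β L t)

/-- The reflected on-axis correlator, order `(Q^θ, Q)`, at separation `n`: `lCC_{β,2L+1}(Q^θ, Q, n)` (so `axisG = (2t)⁸ · lcc (2t)`). -/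
def lcc (r : LatticeRep G) (β : ℝ) (L n : ℕ) : ℝ :=
  latticeConnectedCorr r.ρ β (2 * L + 1) r.curvature.timeReflect.F r.curvature.F n

/-- The reflected on-axis correlator, mirror order `(Q, Q^θ)`: `lCC_{β,2L+1}(Q, Q^θ, n)` (so `axisG' = (2t)⁸ · lcc' (2t)`). -/
def lcc' (r : LatticeRep G) (β : ℝ) (L n : ℕ) : ℝ :=
  latticeConnectedCorr r.ρ β (2 * L + 1) r.curvature.F r.curvature.timeReflect.F n

/-- `axisG = (2t)⁸ · lcc (2t)`. [bookkeeping] -/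
theorem axisG_eq (r : LatticeRep G) (β : ℝ) (L t : ℕ) : axisG r β L t = ((2 * t : ℕ) : ℝ) ^ 8 * lcc r β L (2 * t) := rfl

/-- `axisG' = (2t)⁸ · lcc' (2t)`. [bookkeeping] -/
theorem axisG'_eq (r : LatticeRep G) (β : ℝ) (L t : ℕ) : axisG' r β L t = ((2 * t : ℕ) : ℝ) ^ 8 * lcc' r β L (2 * t) := rfl

end Objects

/-- The one-loop **Möbius map** `M_b(u) = u / (1 + b√u)²` (`1/√(M_b u) = 1/√u + b` for `u > 0`). -/
def moebius (b u : ℝ) : ℝ := u / (1 + b * Real.sqrt u) ^ 2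

/-- **Statement of `stub_moebiusRow` — C⁺ of card A** (UV; THE non-transferring stub; XL): one block step `t ↦ Λt` toward the infrared
LOSES at least `b` in `1/√Gs` — one step toward the ultraviolet contracts the symmetrised coupling `Gs` by the Möbius map — throughout the
INTRINSIC weak-coupling window (`Gs ≤ η` at every scale `≤ Λt`), up to an ARBITRARY floor `δ > 0` reached for `β ≥ β₁(δ)` (`Λ, b, η` chosen
BEFORE `δ`; critic sharpening S1).  Letter = certified Sketch rev 2 with `axisG ↦ axisGs` (both reflection orders; rev 3, g25).  No unit map,
no pinning, no coupling of record in the statement.  (An OPEN statement — the registered stub; sources of the expected mechanism: Bałaban,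
Large field renormalization II, CMP 122 (1989); Magnen–Rivasseau–Sénéor, CMP 155 (1993).  No cite tag here on purpose: this `def` is a crux
letter, not a Literature fact.) -/
def MoebiusRow : Prop :=
  ∀ (G : Type) [Group G] [TopologicalSpace G] [IsTopologicalGroup G] [CompactSpace G],
    IsCompactSimpleLieGroup G →
    letI : MeasurableSpace G := borel G
    haveI : BorelSpace G := ⟨rfl⟩
    ∀ r : LatticeRep G, ∃ (Λ : ℕ) (b η : ℝ), 2 ≤ Λ ∧ 0 < b ∧ 0 < η ∧
      ∀ δ : ℝ, 0 < δ → ∃ β₁ : ℝ, ∀ β : ℝ, β₁ ≤ β → ∀ (L t : ℕ), 1 ≤ t → 4 * (Λ * t) + 8 ≤ L →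
        (∀ s : ℕ, 1 ≤ s → s ≤ Λ * t → axisGs r β L s ≤ η) →
          axisGs r β L t ≤ max δ (moebius b (axisGs r β L (Λ * t)))


/-! ## §2 The three debts -/

section Debts

variable {G : Type} [Group G] [TopologicalSpace G] [IsTopologicalGroup G] [CompactSpace G]
  [MeasurableSpace G] [BorelSpace G]

/-- **U0 `LatticeUVFloor r`** (lattice-artefact floor, S–M): at fixed lattice distances the symmetrised axis coupling vanishes as `β → ∞`,
uniformly in the torus. -/
def LatticeUVFloor (r : LatticeRep G) : Prop :=
  ∀ δ : ℝ, 0 < δ → ∀ T : ℕ, ∃ β₁ : ℝ, ∀ β : ℝ, β₁ ≤ β → ∀ L t : ℕ, 1 ≤ t → t ≤ T → 4 * t + 8 ≤ L →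
    axisGs r β L t ≤ δ

/-- **U1 `ContinuumDictionary r u 𝒢 η₁`** (lattice → finite-volume continuum profile, relative error `ν`, inside the intrinsic weak-coupling
window; XL): `𝒢 ℓ x` = the profile at torus size `ℓ` and separation `x`, `u` = the unit. -/
def ContinuumDictionary (r : LatticeRep G) (u : ℝ → ℝ) (𝒢 : ℝ → ℝ → ℝ) (η₁ : ℝ) : Prop :=
  ∀ ν : ℝ, 0 < ν → ∃ (T : ℕ) (β₁ : ℝ), ∀ β : ℝ, β₁ ≤ β → ∀ L t : ℕ, T ≤ t → 4 * t + 8 ≤ L →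
    (∀ s : ℕ, 1 ≤ s → s ≤ t → axisGs r β L s ≤ η₁) →
      |axisGs r β L t - 𝒢 (((2 * L + 1 : ℕ) : ℝ) * u β) (2 * (t : ℝ) * u β)| ≤
        ν * 𝒢 (((2 * L + 1 : ℕ) : ℝ) * u β) (2 * (t : ℝ) * u β)

/-- **U2 `ProfileAFRow 𝒢`** (continuum composite asymptotic freedom of the finite-volume profile, window ON THE GRID of mesh `h ≤ h₀`; XL):
one block step `x ↦ Λx` loses at least `b` in `1/√𝒢`. -/
def ProfileAFRow (𝒢 : ℝ → ℝ → ℝ) : Prop :=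
  ∃ (Λ : ℕ) (b η₂ h₀ : ℝ), 2 ≤ Λ ∧ 0 < b ∧ 0 < η₂ ∧ 0 < h₀ ∧
    ∀ h : ℝ, 0 < h → h ≤ h₀ → ∀ L t : ℕ, 1 ≤ t → 4 * (Λ * t) + 8 ≤ L →
      (∀ s : ℕ, t ≤ s → s ≤ Λ * t → 𝒢 (((2 * L + 1 : ℕ) : ℝ) * h) (2 * (s : ℝ) * h) ≤ η₂) →
        0 < 𝒢 (((2 * L + 1 : ℕ) : ℝ) * h) (2 * ((Λ * t : ℕ) : ℝ) * h) ∧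
        1 / Real.sqrt (𝒢 (((2 * L + 1 : ℕ) : ℝ) * h) (2 * ((Λ * t : ℕ) : ℝ) * h)) + b ≤
          1 / Real.sqrt (𝒢 (((2 * L + 1 : ℕ) : ℝ) * h) (2 * (t : ℝ) * h))

end Debts

/-- **The packaged debts** `U0 ∧ ∃ (u → 0) 𝒢 η₁, U1 ∧ U2`, for every compact simple `G` and every `r`. -/
def CompositeAFDebts : Prop :=
  ∀ (G : Type) [Group G] [TopologicalSpace G] [IsTopologicalGroup G] [CompactSpace G],
    IsCompactSimpleLieGroup G →
    letI : MeasurableSpace G := borel G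
    haveI : BorelSpace G := ⟨rfl⟩
    ∀ r : LatticeRep G, LatticeUVFloor r ∧
      ∃ (u : ℝ → ℝ) (𝒢 : ℝ → ℝ → ℝ) (η₁ : ℝ), (∀ β, 0 < u β) ∧ Tendsto u atTop (nhds 0) ∧ 0 < η₁ ∧
        ContinuumDictionary r u 𝒢 η₁ ∧ ProfileAFRow 𝒢

/-! ## §3 The reduction (paper proof in the module docstring; PROVED) -/

/-- **The Möbius algebra** (pure real analysis, the heart of the reduction): two-sided relative comparison `ν ≤ 1/4` of `(Gt, GΛ)` with a
profile pair `(gt, gΛ)` obeying the continuum row with gain `b`, in the regime `gΛ ≥ (4ν/b)²`, gives the lattice row with gain `b/2`. -/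
theorem moebius_step {Gt GΛ gt gΛ ν b : ℝ} (hb : 0 < b) (hν : 0 < ν) (hν4 : ν ≤ 1 / 4)
    (hgΛ : 0 < gΛ) (hrow : 1 / Real.sqrt gΛ + b ≤ 1 / Real.sqrt gt)
    (ht : |Gt - gt| ≤ ν * gt) (hΛ : |GΛ - gΛ| ≤ ν * gΛ) (hbig : (4 * ν / b) ^ 2 ≤ gΛ) :
    Gt ≤ moebius (b / 2) GΛ := by
  -- positivity of the four couplings
  have hsgΛ : 0 < Real.sqrt gΛ := Real.sqrt_pos.2 hgΛ
  have hA : 0 < 1 / Real.sqrt gΛ := by positivity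
  have hgt : 0 < gt := by
    by_contra h
    have h0 : Real.sqrt gt = 0 := Real.sqrt_eq_zero'.2 (not_lt.1 h)
    rw [h0, div_zero] at hrow
    linarith
  have hsgt : 0 < Real.sqrt gt := Real.sqrt_pos.2 hgt
  have hGt : 0 < Gt := by have := (abs_le.1 ht).1; nlinarith
  have hGΛ : 0 < GΛ := by have := (abs_le.1 hΛ).1; nlinarith
  have hsGt : 0 < Real.sqrt Gt := Real.sqrt_pos.2 hGt
  have hsGΛ : 0 < Real.sqrt GΛ := Real.sqrt_pos.2 hGΛ
  have hν2 : 0 < 1 - ν / 2 := by linarith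
  -- `A ν ≤ b/4` from the regime hypothesis
  have hsg : 4 * ν / b ≤ Real.sqrt gΛ := by
    rw [show 4 * ν / b = Real.sqrt ((4 * ν / b) ^ 2) from (Real.sqrt_sq (by positivity)).symm]
    exact Real.sqrt_le_sqrt hbig
  have hAν : (1 / Real.sqrt gΛ) * ν ≤ b / 4 := by
    have h1 : 1 / Real.sqrt gΛ ≤ 1 / (4 * ν / b) := one_div_le_one_div_of_le (by positivity) hsg
    rw [one_div_div] at h1
    calc (1 / Real.sqrt gΛ) * ν ≤ b / (4 * ν) * ν := mul_le_mul_of_nonneg_right h1 hν.le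
      _ = b / 4 := by field_simp
  have hνb : ν * b ≤ b / 4 := by nlinarith
  -- upper comparison: `1/√Gt ≥ (1 − ν/2)/√gt`
  have e1 : (1 + ν) * (1 - ν / 2) ^ 2 ≤ 1 := by nlinarith [sq_nonneg ν, mul_pos hν hν]
  have h1 : Gt ≤ gt / (1 - ν / 2) ^ 2 := by
    have hGt' : Gt ≤ (1 + ν) * gt := by have := (abs_le.1 ht).2; linarith
    rw [le_div_iff₀ (by positivity)]
    nlinarith
  have h2 : Real.sqrt Gt ≤ Real.sqrt gt / (1 - ν / 2) := by
    calc Real.sqrt Gt ≤ Real.sqrt (gt / (1 - ν / 2) ^ 2) := Real.sqrt_le_sqrt h1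
      _ = Real.sqrt gt / (1 - ν / 2) := by rw [Real.sqrt_div' _ (by positivity), Real.sqrt_sq hν2.le]
  have h3 : (1 - ν / 2) * (1 / Real.sqrt gt) ≤ 1 / Real.sqrt Gt := by
    rw [mul_one_div, div_le_div_iff₀ hsgt hsGt, one_mul]
    rwa [le_div_iff₀ hν2, mul_comm] at h2
  -- lower comparison: `1/√GΛ ≤ (1 + ν)/√gΛ`
  have e2 : 1 ≤ (1 - ν) * (1 + ν) ^ 2 := by
    have : 0 < 1 - ν - ν ^ 2 := by nlinarith
    nlinarith [mul_pos hν this]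
  have h4 : gΛ / (1 + ν) ^ 2 ≤ GΛ := by
    have hGΛ' : (1 - ν) * gΛ ≤ GΛ := by have := (abs_le.1 hΛ).1; linarith
    rw [div_le_iff₀ (by positivity)]
    nlinarith
  have h5 : Real.sqrt gΛ / (1 + ν) ≤ Real.sqrt GΛ := by
    calc Real.sqrt gΛ / (1 + ν) = Real.sqrt (gΛ / (1 + ν) ^ 2) := by
          rw [Real.sqrt_div' _ (by positivity), Real.sqrt_sq (by linarith)]
      _ ≤ Real.sqrt GΛ := Real.sqrt_le_sqrt h4
  have h6 : 1 / Real.sqrt GΛ ≤ (1 + ν) * (1 / Real.sqrt gΛ) := by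
    have := one_div_le_one_div_of_le (by positivity) h5
    rw [one_div_div] at this
    rw [mul_one_div]
    exact this
  -- the middle step (uses `A ν ≤ b/4`, `ν ≤ 1/4`)
  have hmid : (1 + ν) * (1 / Real.sqrt gΛ) + b / 2 ≤ (1 - ν / 2) * (1 / Real.sqrt gΛ + b) := by
    nlinarith [hAν, hνb, hA, hb]
  -- the chain `1/√GΛ + b/2 ≤ 1/√Gt`
  have key : 1 / Real.sqrt GΛ + b / 2 ≤ 1 / Real.sqrt Gt := by
    calc 1 / Real.sqrt GΛ + b / 2 ≤ (1 + ν) * (1 / Real.sqrt gΛ) + b / 2 := by linarith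
      _ ≤ (1 - ν / 2) * (1 / Real.sqrt gΛ + b) := hmid
      _ ≤ (1 - ν / 2) * (1 / Real.sqrt gt) := mul_le_mul_of_nonneg_left hrow hν2.le
      _ ≤ 1 / Real.sqrt Gt := h3
  -- and the Möbius form of the conclusion
  have hc : 0 ≤ b / 2 := by positivity
  have hnum : 0 < 1 + b / 2 * Real.sqrt GΛ := by positivity
  have key' : Real.sqrt Gt * (1 + b / 2 * Real.sqrt GΛ) ≤ Real.sqrt GΛ := by
    have e : 1 / Real.sqrt GΛ + b / 2 = (1 + b / 2 * Real.sqrt GΛ) / Real.sqrt GΛ := by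
      field_simp
    rw [e, div_le_div_iff₀ hsGΛ hsGt, one_mul] at key
    linarith
  unfold moebius
  rw [le_div_iff₀ (pow_pos hnum 2)]
  have h0 : 0 ≤ Real.sqrt Gt * (1 + b / 2 * Real.sqrt GΛ) := by positivity
  have hsq := mul_le_mul key' key' h0 hsGΛ.le
  rw [Real.mul_self_sqrt hGΛ.le] at hsq
  calc Gt * (1 + b / 2 * Real.sqrt GΛ) ^ 2
      = Real.sqrt Gt * (1 + b / 2 * Real.sqrt GΛ) * (Real.sqrt Gt * (1 + b / 2 * Real.sqrt GΛ)) := by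
        linear_combination (-(1 + b / 2 * Real.sqrt GΛ) ^ 2) * Real.mul_self_sqrt hGt.le
    _ ≤ GΛ := hsq

/-- **`CompositeAFDebts → MoebiusRow`** (the debt certificate; proof = module docstring, via `moebius_step`).  The hypothesis is an OPEN debt
(U1, U2 XL); nothing about Yang–Mills is proved by this reduction. [cite: Balaban1989LargeFieldII, LRYM II] [cite: MagnenRivasseauSeneor1993] -/
theorem moebiusRow_of_debts (h : CompositeAFDebts) : MoebiusRow := by
  intro G _ _ _ _ hG
  letI : MeasurableSpace G := borel G
  haveI : BorelSpace G := ⟨rfl⟩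
  intro r
  obtain ⟨hU0, u, 𝒢, η₁, hu, hu0, hη₁, hU1, hU2⟩ := h G hG r
  obtain ⟨Λ, b, η₂, h₀, hΛ, hb, hη₂, hh₀, hrow⟩ := hU2
  refine ⟨Λ, b / 2, min η₁ (η₂ / 2), hΛ, by positivity, lt_min hη₁ (by positivity), ?_⟩
  intro δ hδ
  -- the relative dictionary error `ν`
  set ν : ℝ := min (1 / 4) (b * Real.sqrt δ / 8) with hν_def
  have hν : 0 < ν := lt_min (by norm_num) (by positivity)
  have hν4 : ν ≤ 1 / 4 := min_le_left _ _
  have hνδ : ν ≤ b * Real.sqrt δ / 8 := min_le_right _ _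
  obtain ⟨T, β₁', hdict⟩ := hU1 ν hν
  obtain ⟨β₀, hfloor⟩ := hU0 δ hδ T
  obtain ⟨βᵤ, hβᵤ⟩ := eventually_atTop.1 (hu0.eventually (Iic_mem_nhds hh₀))
  refine ⟨max (max β₁' β₀) βᵤ, ?_⟩
  intro β hβ L t ht hL hwin
  have hβ1 : β₁' ≤ β := le_trans (le_trans (le_max_left _ _) (le_max_left _ _)) hβ
  have hβ0 : β₀ ≤ β := le_trans (le_trans (le_max_right _ _) (le_max_left _ _)) hβ
  have hβu : u β ≤ h₀ := hβᵤ β (le_trans (le_max_right _ _) hβ)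
  have hΛ1 : 1 ≤ Λ := by omega
  have htΛ : t ≤ Λ * t := Nat.le_mul_of_pos_left t (by omega)
  have hL4 : 4 * t + 8 ≤ L := by nlinarith
  by_cases htT : t < T
  · -- CASE `t < T`: the lattice-artefact floor
    exact (hfloor β hβ0 L t ht htT.le hL4).trans (le_max_left _ _)
  -- CASE `T ≤ t`: dictionary + continuum row
  have hTt : T ≤ t := not_lt.1 htT
  have hη : min η₁ (η₂ / 2) ≤ η₁ := min_le_left _ _
  have hη' : min η₁ (η₂ / 2) ≤ η₂ / 2 := min_le_right _ _
  -- the dictionary at every grid scale `s ∈ [t, Λt]`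
  have hd : ∀ s : ℕ, t ≤ s → s ≤ Λ * t →
      |axisGs r β L s - 𝒢 (((2 * L + 1 : ℕ) : ℝ) * u β) (2 * (s : ℝ) * u β)| ≤
        ν * 𝒢 (((2 * L + 1 : ℕ) : ℝ) * u β) (2 * (s : ℝ) * u β) := by
    intro s hts hsΛ
    refine hdict β hβ1 L s (hTt.trans hts) (by nlinarith) fun s' hs'1 hs's => ?_
    exact (hwin s' hs'1 (hs's.trans hsΛ)).trans hη
  -- the U2 grid window
  have hgrid : ∀ s : ℕ, t ≤ s → s ≤ Λ * t → 𝒢 (((2 * L + 1 : ℕ) : ℝ) * u β) (2 * (s : ℝ) * u β) ≤ η₂ := by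
    intro s hts hsΛ
    have h1 := hd s hts hsΛ
    have h2 : axisGs r β L s ≤ η₂ / 2 := (hwin s (ht.trans hts) hsΛ).trans hη'
    have h3 := (abs_le.1 h1).1
    nlinarith
  obtain ⟨hpos, hineq⟩ := hrow (u β) (hu β) hβu L t ht hL hgrid
  -- abbreviations for the two profile values
  set gΛ : ℝ := 𝒢 (((2 * L + 1 : ℕ) : ℝ) * u β) (2 * ((Λ * t : ℕ) : ℝ) * u β) with hgΛ_def
  set gt : ℝ := 𝒢 (((2 * L + 1 : ℕ) : ℝ) * u β) (2 * (t : ℝ) * u β) with hgt_def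
  have hdt : |axisGs r β L t - gt| ≤ ν * gt := hd t le_rfl htΛ
  have hdΛ : |axisGs r β L (Λ * t) - gΛ| ≤ ν * gΛ := by
    have := hd (Λ * t) htΛ le_rfl
    simpa only [hgΛ_def] using this
  by_cases hbig : (4 * ν / b) ^ 2 ≤ gΛ
  · -- regime `gΛ ≥ (4ν/b)²`: the Möbius step with gain `b/2`
    exact (moebius_step hb hν hν4 hpos hineq hdt hdΛ hbig).trans (le_max_right _ _)
  · -- regime `gΛ < (4ν/b)²`: everything is below the floor
    have hsmall : gΛ < (4 * ν / b) ^ 2 := lt_of_not_ge hbig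
    have hsgΛ : 0 < Real.sqrt gΛ := Real.sqrt_pos.2 hpos
    have hgt : 0 < gt := by
      by_contra h'
      have h0 : Real.sqrt gt = 0 := Real.sqrt_eq_zero'.2 (not_lt.1 h')
      rw [h0, div_zero] at hineq
      have : 0 < 1 / Real.sqrt gΛ := by positivity
      linarith
    have hgtΛ : gt ≤ gΛ := by
      have h1 : 1 / Real.sqrt gΛ ≤ 1 / Real.sqrt gt := by linarith
      have h2 : Real.sqrt gt ≤ Real.sqrt gΛ := (one_div_le_one_div hsgΛ (Real.sqrt_pos.2 hgt)).1 h1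
      exact (Real.sqrt_le_sqrt_iff hpos.le).1 h2
    have hGt : axisGs r β L t ≤ (1 + ν) * gt := by have := (abs_le.1 hdt).2; linarith
    have hν2 : ν ^ 2 ≤ b ^ 2 * δ / 64 := by
      have h1 : 0 ≤ b * Real.sqrt δ / 8 := by positivity
      have := pow_le_pow_left₀ hν.le hνδ 2
      rw [div_pow, mul_pow, Real.sq_sqrt hδ.le] at this
      linarith
    have hfin : axisGs r β L t ≤ δ := by
      have e : (4 * ν / b) ^ 2 = 16 * ν ^ 2 / b ^ 2 := by rw [div_pow, mul_pow]; norm_num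
      rw [e] at hsmall
      have hb2 : 0 < b ^ 2 := by positivity
      have h16 : 16 * ν ^ 2 / b ^ 2 ≤ δ / 4 := by
        rw [div_le_iff₀ hb2]
        nlinarith
      nlinarith
    exact hfin.trans (le_max_left _ _)

end Summit.QuantumFields.YangMills.Cruxes.SubCurvatureClause.MoebiusRowDebts

end
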